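import Summits.ResolutionOfSingularities.ResolutionOfSingularities.Theorems.PurelyInseparableDim4ParamCertSixSound
import Summits.ResolutionOfSingularities.ResolutionOfSingularities.Theorems.PurelyInseparableDim4LocalGameTorus
import HarnessLib

/-!
# [OURS · res-dim4-pi · F4-C-loc] PARAMETRIC CERTIFICATES, format v7: two new ROW kinds — TORUS (the fibre letter is
  scaled away) and PIN (the letter is pinned to the rational roots of an ambiguous low coefficient) — with soundness

Cell `res-dim4-pi` (D-0157 DOOR 2, wave 2), seat `res-dim4-p-6` g4; sequel of `…ParamCertSix(Sound)` (v6 chart trees) and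
`…LocalGameTorus` (the local game is torus-invariant).  Rows `(L, cert)` with `cert : PRowCert7 k`:

* `six c` — a v6 row (blind | coat | move), checked by `prow6B` against the later rows PROJECTED to v6 rows (`proj6`:
  only the term lists matter to `memRow6B`), so the v6 node checker and `pnode6_sound` are reused verbatim;
* **`torus w N`** (`w : Fin 4 → ℤ`, `N : ℤ`): every term `c·x^e·t^a` of `L` has `a + w·e = N`; then
  `spec f β (evalT L) = β^N · (spec f β (evalT L₁))(β^{−w}x)` with `L₁ = normT (setT0 L)` the LETTER-FREE representative, a
  later row; sound by `Torus.rWins_C_mul_scale_iff` — the TORUS RULE of the census (binomial roots: 53 FAIL → 1,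
  CANDIDATE);
* **`pin γ d₀ A rts`**: `x^γ` is low (`γ ≠ 0`, `|γ| < q`) and the letter polynomial of its coefficient IS
  `A·T^{d₀}·∏(T − ρ)^m` (`rootsPolyL A d₀ rts []`, `A ≠ 0`): either that coefficient is non-zero at `β` — then NO coordinate centre is permissible
  and the position is terminal (won) — or `β = f ρ` for a listed `ρ`, and the pinned rational row `normT (pinT ρ L)` is a
  later row.
* checker **`pcert7B`**, soundness **`pwin_of_pcert7B`**, entry **`rWins_liftState_of_pcert7B`**.

[OURS · counted 0 · certificate format + soundness; AI kernel work, weaker than expert review.]  NOTHING here is a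
statement about resolution of singularities; resolution in dimension `≥ 4` / characteristic `p > 0` is NOT proved by
anything in this file.  bears_on: LADDER-RESOLUTION:D157-DOOR2 (res-dim4-pi · F4-C-loc all fields · rows v7).  Host item
(DR-157-C): `stmt-ResolutionOfSingularities-16155`, helper.
-/

set_option linter.dupNamespace false -- mandated namespace of this single-conjunct summit

noncomputable section

open MvPolynomial Finset
open scoped BigOperators

namespace Summit.ResolutionOfSingularities.ResolutionOfSingularities.Theorems.PIDim4

namespace LoopCLocal

open Literature.AlgebraicGeometry.Resolution
open Literature.AlgebraicGeometry.Resolution.Hauser2010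
open Literature.AlgebraicGeometry.Resolution.CentreBlowup
open StepKit ParamLift

section Format

variable {k : Type} [Field k] [DecidableEq k]

/-! ## §1 The format -/

/-- a v7 row certificate. OURS. [folklore] -/
inductive PRowCert7 (k : Type) : Type
  /-- a v6 row (blind | coat | move) -/
  | six (c : PRowCert6 k)
  /-- the letter is scaled away: `a + w·e = N` on every term; the letter-free representative is a later row -/
  | torus (w : Fin 4 → ℤ) (N : ℤ)
  /-- the letter is pinned by the low exponent `γ`: its letter polynomial is `A·T^{d₀}·∏(T − ρ)^m`; pinned rows are later -/
  | pin (γ : Fin 4 → ℕ) (d₀ : ℕ) (A : k) (rts : List (k × ℕ))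

/-- a v7 row. OURS. [folklore] -/
abbrev PRow7 (k : Type) : Type := Terms 5 k × PRowCert7 k

/-- projection to v6 rows (dummy certificates; `memRow6B` reads the term lists only). OURS. [folklore] -/
def proj6 (rest : List (PRow7 k)) : List (PRow6 k) :=
  rest.map fun r => (r.1, PRowCert6.move ∅ fun _ => PNode6.child)

/-- the letter-free representative: every letter exponent set to `0`. OURS. [folklore] -/
def setT0 (L : Terms 5 k) : Terms 5 k := L.map fun t => (Function.update t.1 (Fin.last 4) 0, t.2)

/-- the row pinned at the rational letter value `ρ`: `c·x^e·t^a ↦ c ρ^a·x^e`. OURS. [folklore] -/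
def pinT (ρ : k) (L : Terms 5 k) : Terms 5 k := L.map fun t => (Function.update t.1 (Fin.last 4) 0, t.2 * ρ ^ t.1 (Fin.last 4))

/-- the collected letter coefficient of `x^γ` at letter power `a`. OURS. [folklore] -/
def tCoef (γ : Fin 4 → ℕ) (L : Terms 5 k) (a : ℕ) : k :=
  ((L.filter fun t => decide (Fin.init t.1 = γ) && decide (t.1 (Fin.last 4) = a)).map fun t => t.2).sum

/-- the v7 row check. OURS. [folklore] -/
def prow7B (q : ℕ) (rest : List (PRow7 k)) : PRow7 k → Bool
  | (L, PRowCert7.six c) => prow6B q (proj6 rest) (L, c)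
  | (L, PRowCert7.torus w N) =>
      decide (∀ t ∈ L, (t.1 (Fin.last 4) : ℤ) + ∑ i : Fin 4, w i * (t.1 i.castSucc : ℤ) = N) &&
        memRow6B (normT (setT0 L)) (proj6 rest)
  | (L, PRowCert7.pin γ d₀ A rts) =>
      !decide (γ = 0) && decide (∑ i, γ i < q) && !decide (A = 0) &&
        decide (∀ t ∈ L, Fin.init t.1 = γ → t.1 (Fin.last 4) < (rootsPolyL A d₀ rts []).length) &&
        ((List.range (rootsPolyL A d₀ rts []).length).all fun a =>
          decide (tCoef γ L a = (rootsPolyL A d₀ rts []).getD a 0)) &&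
        decide (∀ ρm ∈ rts, memRow6B (normT (pinT ρm.1 L)) (proj6 rest) = true)

/-- **the v7 certificate checker**: rows in order, children later. OURS. [folklore] -/
def pcert7B (q : ℕ) : List (PRow7 k) → Bool
  | [] => true
  | row :: rest => prow7B q rest row && pcert7B q rest

end Format

/-! ## §2 Soundness -/

section Sound

variable {k K : Type} [Field k] [Field K] [DecidableEq k] [DecidableEq K] (f : k →+* K)

omit [Field k] [Field K] [DecidableEq k] [DecidableEq K] in
/-- rows of the projection are term lists of the v7 rows. OURS. [folklore] -/
theorem mem_proj6 {rest : List (PRow7 k)} {row : PRow6 k} (h : row ∈ proj6 rest) : ∃ r ∈ rest, row.1 = r.1 := by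
  unfold proj6 at h
  obtain ⟨r, hr, rfl⟩ := List.mem_map.mp h
  exact ⟨r, hr, rfl⟩

omit [DecidableEq k] in
/-- the induction hypothesis descends to the projection. OURS. [folklore] -/
theorem hrest_proj6 {q : ℕ} {rest : List (PRow7 k)}
    (hrest : ∀ row ∈ rest, (∀ β : K, β ≠ 0 → ∀ (r : Fin 4 →₀ ℕ) (exc : Finset (Fin 4)),
      RWins q localB (⟨spec f β (evalT row.1), r, exc⟩ : State K))) :
    ∀ row ∈ proj6 rest, (∀ β : K, β ≠ 0 → ∀ (r : Fin 4 →₀ ℕ) (exc : Finset (Fin 4)),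
      RWins q localB (⟨spec f β (evalT row.1), r, exc⟩ : State K)) := by
  intro row hrow
  obtain ⟨r, hr, h1⟩ := mem_proj6 hrow
  rw [h1]
  exact hrest r hr

omit [DecidableEq k] [DecidableEq K] in
/-- the letter-free representative does not see the letter. OURS. [folklore] -/
theorem spec_setT0_eq (β β' : K) (L : Terms 5 k) : spec f β (evalT (setT0 L)) = spec f β' (evalT (setT0 L)) := by
  induction L with
  | nil => simp [setT0]
  | cons t L ih =>
    simp only [setT0, List.map_cons, evalT_cons, map_add] at ih ⊢
    rw [ih, spec_monomial_update, spec_monomial_update, pow_zero, pow_zero]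

omit [DecidableEq k] [DecidableEq K] in
/-- the affine exponent identity in the field: `β^a = β^N · ∏ (β^{−wᵢ})^{eᵢ}`. OURS. [folklore] -/
theorem zpow_affine {β : K} (hβ : β ≠ 0) (a : ℕ) (e : Fin 4 → ℕ) (w : Fin 4 → ℤ) (N : ℤ)
    (h : (a : ℤ) + ∑ i : Fin 4, w i * (e i : ℤ) = N) :
    β ^ a = β ^ N * ∏ i : Fin 4, (β ^ (-w i)) ^ e i := by
  have hprod : (∏ i : Fin 4, (β ^ (-w i)) ^ e i) = β ^ (-(∑ i : Fin 4, w i * (e i : ℤ))) := by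
    rw [Fin.prod_univ_four, Fin.sum_univ_four]
    simp only [← zpow_natCast, ← zpow_mul, neg_add, zpow_add₀ hβ]
    ring_nf
  rw [hprod, ← zpow_add₀ hβ, ← h, add_neg_cancel_right, zpow_natCast]

omit [DecidableEq k] [DecidableEq K] in
/-- **the torus identity of a row**: `spec f β (evalT L) = β^N · (spec f β (evalT (setT0 L)))(β^{−w}·x)`. OURS. [folklore] -/
theorem spec_eq_C_mul_scale_of_affine {β : K} (hβ : β ≠ 0) {w : Fin 4 → ℤ} {N : ℤ} :
    ∀ L : Terms 5 k, (∀ t ∈ L, (t.1 (Fin.last 4) : ℤ) + ∑ i : Fin 4, w i * (t.1 i.castSucc : ℤ) = N) →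
      spec f β (evalT L) = C (β ^ N) * aeval (fun i => C (β ^ (-w i)) * X i) (spec f β (evalT (setT0 L)))
  | [], _ => by simp [setT0]
  | t :: L, h => by
    have ih := spec_eq_C_mul_scale_of_affine hβ L fun t' ht' => h t' (List.mem_cons_of_mem _ ht')
    have haff := h t List.mem_cons_self
    simp only [setT0, List.map_cons, evalT_cons, map_add, mul_add] at ih ⊢
    rw [ih]
    congr 1
    have hL : spec f β (monomial (expo t.1) t.2) = monomial (expo (Fin.init t.1)) (f t.2 * β ^ t.1 (Fin.last 4)) := by
      rw [spec_monomial, C_mul_monomial, mul_one]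
    have hR : C (β ^ N) * aeval (fun i => C (β ^ (-w i)) * X i)
        (spec f β (monomial (expo (Function.update t.1 (Fin.last 4) 0)) t.2)) =
        monomial (expo (Fin.init t.1)) (β ^ N * (f t.2 * ∏ i : Fin 4, (β ^ (-w i)) ^ (expo (Fin.init t.1)) i)) := by
      rw [spec_monomial_update, pow_zero, mul_one, map_mul, aeval_C, algebraMap_eq, Torus.scale_monomial, one_mul,
        C_mul_monomial, C_mul_monomial]
    rw [hL, hR, zpow_affine hβ (t.1 (Fin.last 4)) (fun i => (expo (Fin.init t.1)) i) w N haff]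
    congr 1
    ring

/-- **soundness of a TORUS row.** OURS. [folklore] -/
theorem pwin_of_torus {q : ℕ} {rest : List (PRow7 k)}
    (hrest : ∀ row ∈ rest, (∀ β : K, β ≠ 0 → ∀ (r : Fin 4 →₀ ℕ) (exc : Finset (Fin 4)),
      RWins q localB (⟨spec f β (evalT row.1), r, exc⟩ : State K))) {L : Terms 5 k} {w : Fin 4 → ℤ} {N : ℤ}
    (haff : ∀ t ∈ L, (t.1 (Fin.last 4) : ℤ) + ∑ i : Fin 4, w i * (t.1 i.castSucc : ℤ) = N)
    (hmem : memRow6B (normT (setT0 L)) (proj6 rest) = true) {β : K} (hβ : β ≠ 0) (r : Fin 4 →₀ ℕ) (exc : Finset (Fin 4)) :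
    RWins q localB (⟨spec f β (evalT L), r, exc⟩ : State K) := by
  rw [spec_eq_C_mul_scale_of_affine f hβ L haff,
    Torus.rWins_C_mul_scale_iff (zpow_ne_zero _ hβ) (fun i => zpow_ne_zero _ hβ)]
  have hw := pwin_of_memRow6B f (hrest_proj6 f hrest) hmem β hβ r exc
  rwa [evalT_normT] at hw

omit [DecidableEq k] [DecidableEq K] in
/-- the Taylor term at the origin: only the exact x-part survives. OURS. [folklore] -/
theorem pterm_zero (β : K) (γ : Fin 4 → ℕ) (t : (Fin 5 → ℕ) × k) :
    pterm f β γ (0 : Fin 4 → K) t = if Fin.init t.1 = γ then f t.2 * β ^ t.1 (Fin.last 4) else 0 := by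
  unfold pterm
  split_ifs with h
  · have hprod : (∏ i : Fin 4, (((t.1 i.castSucc).choose (γ i) : K) * (0 : Fin 4 → K) i ^ (t.1 i.castSucc - γ i))) = 1 :=
      Finset.prod_eq_one fun i _ => by
        have : t.1 i.castSucc = γ i := by rw [← h]; rfl
        rw [this, Nat.choose_self, Nat.sub_self, pow_zero, Nat.cast_one, mul_one]
    rw [hprod, mul_one]
  · have : ∃ i : Fin 4, t.1 i.castSucc ≠ γ i := by
      by_contra hcon
      push Not at hcon
      exact h (funext fun i => hcon i)
    obtain ⟨i, hi⟩ := this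
    rw [Finset.prod_eq_zero (Finset.mem_univ i), mul_zero]
    rcases Nat.lt_or_gt_of_ne hi with hlt | hgt
    · rw [Nat.choose_eq_zero_of_lt hlt, Nat.cast_zero, zero_mul]
    · rw [Pi.zero_apply, zero_pow (by omega), mul_zero]

omit [Field K] [DecidableEq k] [DecidableEq K] in
/-- `tCoef` of a cons. OURS. [folklore] -/
theorem tCoef_cons (γ : Fin 4 → ℕ) (t : (Fin 5 → ℕ) × k) (L : Terms 5 k) (a : ℕ) :
    tCoef γ (t :: L) a = (if Fin.init t.1 = γ ∧ t.1 (Fin.last 4) = a then t.2 else 0) + tCoef γ L a := by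
  unfold tCoef
  rw [List.filter_cons]
  by_cases h : Fin.init t.1 = γ ∧ t.1 (Fin.last 4) = a
  · have hb : (decide (Fin.init t.1 = γ) && decide (t.1 (Fin.last 4) = a)) = true := by
      rw [Bool.and_eq_true, decide_eq_true_eq, decide_eq_true_eq]; exact h
    rw [if_pos hb, if_pos h, List.map_cons, List.sum_cons]
  · have hb : ¬ ((decide (Fin.init t.1 = γ) && decide (t.1 (Fin.last 4) = a)) = true) := by
      rw [Bool.and_eq_true, decide_eq_true_eq, decide_eq_true_eq]; exact h
    rw [if_neg hb, if_neg h, zero_add]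

omit [DecidableEq k] [DecidableEq K] in
/-- **the coefficient of `x^γ` in a specialised row is the evaluation of its letter polynomial.** OURS. [folklore] -/
theorem coeff_spec_eq_sum_tCoef (β : K) (γ : Fin 4 → ℕ) (M : ℕ) :
    ∀ L : Terms 5 k, (∀ t ∈ L, Fin.init t.1 = γ → t.1 (Fin.last 4) < M) →
      coeff (expo γ) (spec f β (evalT L)) = ∑ a ∈ Finset.range M, f (tCoef γ L a) * β ^ a
  | [], _ => by simp [tCoef]
  | t :: L, hM => by
    have ih := coeff_spec_eq_sum_tCoef β γ M L fun t' ht' => hM t' (List.mem_cons_of_mem _ ht')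
    have h0 := coeff_translate_spec_evalT f β γ (0 : Fin 4 → K) (t :: L)
    have h0' := coeff_translate_spec_evalT f β γ (0 : Fin 4 → K) L
    rw [PointBlowup.translate_zero] at h0 h0'
    rw [h0, List.map_cons, List.sum_cons, ← h0', ih, pterm_zero]
    have hsplit : ∑ a ∈ Finset.range M, f (tCoef γ (t :: L) a) * β ^ a =
        (∑ a ∈ Finset.range M, f (if Fin.init t.1 = γ ∧ t.1 (Fin.last 4) = a then t.2 else 0) * β ^ a) +
          ∑ a ∈ Finset.range M, f (tCoef γ L a) * β ^ a := by
      rw [← Finset.sum_add_distrib]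
      exact Finset.sum_congr rfl fun a _ => by rw [tCoef_cons, map_add, add_mul]
    rw [hsplit]
    congr 1
    by_cases hγ : Fin.init t.1 = γ
    · rw [if_pos hγ]
      have hmem : t.1 (Fin.last 4) ∈ Finset.range M := Finset.mem_range.mpr (hM t List.mem_cons_self hγ)
      symm
      calc ∑ a ∈ Finset.range M, f (if Fin.init t.1 = γ ∧ t.1 (Fin.last 4) = a then t.2 else 0) * β ^ a
          = ∑ a ∈ Finset.range M, (if t.1 (Fin.last 4) = a then f t.2 * β ^ a else 0) :=
            Finset.sum_congr rfl fun a _ => by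
              by_cases ha : t.1 (Fin.last 4) = a
              · rw [if_pos ⟨hγ, ha⟩, if_pos ha]
              · rw [if_neg (fun h => ha h.2), if_neg ha, map_zero, zero_mul]
        _ = f t.2 * β ^ t.1 (Fin.last 4) := by rw [Finset.sum_ite_eq, if_pos hmem]
    · rw [if_neg hγ]
      symm
      exact Finset.sum_eq_zero fun a _ => by rw [if_neg (fun h => hγ h.1), map_zero, zero_mul]

omit [DecidableEq k] [DecidableEq K] in
/-- **a non-zero low coefficient forbids every coordinate centre.** OURS. [folklore] -/
theorem not_isPermissibleCentre_of_coeff_ne_zero {q : ℕ} {γ : Fin 4 → ℕ} (hγq : ∑ i, γ i < q)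
    {F : MvPolynomial (Fin 4) K} (hc : coeff (expo γ) F ≠ 0) (S : Finset (Fin 4)) : ¬ IsPermissibleCentre q S F := by
  rintro ⟨-, hord⟩
  have h1 : ordAlong S F ≤ (degIn S (expo γ) : ℕ∞) := Finset.inf_le (MvPolynomial.mem_support_iff.mpr hc)
  have h2 : degIn S (expo γ) ≤ ∑ i, γ i := by
    rw [degIn_expo]
    exact Finset.sum_le_sum_of_subset_of_nonneg (Finset.subset_univ S) fun _ _ _ => Nat.zero_le _
  have := le_trans hord h1
  have : (q : ℕ∞) ≤ ((∑ i, γ i : ℕ) : ℕ∞) := le_trans this (by exact_mod_cast h2)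
  exact absurd (by exact_mod_cast this : q ≤ ∑ i, γ i) (not_le.mpr hγq)

omit [DecidableEq k] [DecidableEq K] in
/-- **pinning**: at `β = f ρ` the row is the pinned rational row (read at any letter value). OURS. [folklore] -/
theorem spec_pin_eq (ρ : k) (β' : K) : ∀ L : Terms 5 k, spec f (f ρ) (evalT L) = spec f β' (evalT (pinT ρ L))
  | [] => by simp [pinT]
  | t :: L => by
    have ih := spec_pin_eq ρ β' L
    simp only [pinT, List.map_cons, evalT_cons, map_add] at ih ⊢
    rw [ih, spec_monomial, spec_monomial_update, pow_zero, mul_one, map_mul f, map_pow f]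

/-- **soundness of a PIN row.** OURS. [folklore] -/
theorem pwin_of_pin {q : ℕ} {rest : List (PRow7 k)}
    (hrest : ∀ row ∈ rest, (∀ β : K, β ≠ 0 → ∀ (r : Fin 4 →₀ ℕ) (exc : Finset (Fin 4)),
      RWins q localB (⟨spec f β (evalT row.1), r, exc⟩ : State K))) {L : Terms 5 k} {γ : Fin 4 → ℕ} {A : k}
    {d₀ : ℕ} {rts : List (k × ℕ)} (hγq : ∑ i, γ i < q) (hA : A ≠ 0)
    (hM : ∀ t ∈ L, Fin.init t.1 = γ → t.1 (Fin.last 4) < (rootsPolyL A d₀ rts []).length)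
    (hcoef : ∀ a, a < (rootsPolyL A d₀ rts []).length → tCoef γ L a = (rootsPolyL A d₀ rts []).getD a 0)
    (hrows : ∀ ρm ∈ rts, memRow6B (normT (pinT ρm.1 L)) (proj6 rest) = true) {β : K} (hβ : β ≠ 0)
    (r : Fin 4 →₀ ℕ) (exc : Finset (Fin 4)) : RWins q localB (⟨spec f β (evalT L), r, exc⟩ : State K) := by
  set R := rootsPolyL A d₀ rts [] with hR
  have hco : coeff (expo γ) (spec f β (evalT L)) = evalL f R β := by
    rw [coeff_spec_eq_sum_tCoef f β γ R.length L hM, evalL_eq_sum]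
    exact Finset.sum_congr rfl fun a ha => by rw [hcoef a (Finset.mem_range.mp ha)]
  by_cases hzero : evalL f R β = 0
  · -- β is a listed rational root
    rcases root_cases_of_eval_eq_zero f hA hzero with ⟨-, hβ0⟩ | ⟨ρm, hρm, hβρ⟩ | ⟨c, hc, -⟩
    · exact absurd hβ0 hβ
    · rw [hβρ, spec_pin_eq f ρm.1 β L, ← evalT_normT]
      exact pwin_of_memRow6B f (hrest_proj6 f hrest) (hrows ρm hρm) β hβ r exc
    · exact absurd hc List.not_mem_nil
  · -- the low coefficient is non-zero: no permissible centre, terminal position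
    rw [← hco] at hzero
    exact Game.Wins.terminal fun S hS => not_isPermissibleCentre_of_coeff_ne_zero hγq hzero S hS.2

/-- **soundness of one v7 row.** OURS. [folklore] -/
theorem pwin_of_prow7B {q : ℕ} (hq : 2 ≤ q) {rest : List (PRow7 k)}
    (hrest : ∀ row ∈ rest, (∀ β : K, β ≠ 0 → ∀ (r : Fin 4 →₀ ℕ) (exc : Finset (Fin 4)),
      RWins q localB (⟨spec f β (evalT row.1), r, exc⟩ : State K))) {row : PRow7 k}
    (h : prow7B q rest row = true) :
    (∀ β : K, β ≠ 0 → ∀ (r : Fin 4 →₀ ℕ) (exc : Finset (Fin 4)),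
      RWins q localB (⟨spec f β (evalT row.1), r, exc⟩ : State K)) := by
  obtain ⟨L, cert⟩ := row
  intro β hβ r exc
  cases cert with
  | six c =>
    simp only [prow7B] at h
    exact pwin_of_prow6B f hq (hrest_proj6 f hrest) h β hβ r exc
  | torus w N =>
    simp only [prow7B, Bool.and_eq_true, decide_eq_true_eq] at h
    exact pwin_of_torus f hrest h.1 h.2 hβ r exc
  | pin γ d₀ A rts =>
    simp only [prow7B, Bool.and_eq_true, Bool.not_eq_true', decide_eq_false_iff_not, decide_eq_true_eq,
      List.all_eq_true, List.mem_range] at h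
    obtain ⟨⟨⟨⟨⟨-, hγq⟩, hA⟩, hM⟩, hcoef⟩, hrows⟩ := h
    exact pwin_of_pin f hrest hγq hA hM hcoef hrows hβ r exc

/-- **SOUNDNESS OF v7 CERTIFICATES**: every row of a checked table is certified. OURS. [folklore] -/
theorem pwin_of_pcert7B {q : ℕ} (hq : 2 ≤ q) : ∀ {T : List (PRow7 k)}, pcert7B q T = true → ∀ row ∈ T,
    (∀ β : K, β ≠ 0 → ∀ (r : Fin 4 →₀ ℕ) (exc : Finset (Fin 4)),
      RWins q localB (⟨spec f β (evalT row.1), r, exc⟩ : State K))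
  | [], _ => fun row hrow => absurd hrow List.not_mem_nil
  | row :: rest, h => by
    unfold pcert7B at h
    rw [Bool.and_eq_true] at h
    have hrest := pwin_of_pcert7B hq h.2
    intro r hr
    rcases List.mem_cons.mp hr with rfl | hr'
    · exact pwin_of_prow7B f hq hrest h.1
    · exact hrest r hr'

end Sound

/-! ## §3 Entry point -/

/-- **an `𝔽₃` state whose embedding heads a checked v7 table is a LOCAL A-win over EVERY field of characteristic 3.**
OURS. [folklore] -/
theorem rWins_liftState_of_pcert7B (L : Type) [Field L] [CharP L 3] [DecidableEq L] {s : SData 4 (ZMod 3)}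
    {cert : PRowCert7 (ZMod 3)} {rest : List (PRow7 (ZMod 3))} (h : pcert7B 3 ((embed s.L, cert) :: rest) = true) :
    RWins 3 localB (liftState L s.toState) := by
  have hw := pwin_of_pcert7B (φ3 L) (by norm_num) h (embed s.L, cert) List.mem_cons_self 1 one_ne_zero (expo s.r) s.exc
  rw [spec_embed] at hw
  exact hw

end LoopCLocal

end Summit.ResolutionOfSingularities.ResolutionOfSingularities.Theorems.PIDim4

end
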